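import Summits.MatrixMultiplication.OmegaCensus.STPPSmallPatternKernelSearch122R

/-!
# ω-census, `(1,2,2)^4` in `ℤ/2 × ℤ/2 × ℤ/2 × ℤ/2 × ℤ/2`: the PAIR-CLASS LIST of the min-flag normal form (data)

HONEST FRAMING (pub-omega census; verbatim): lottery ticket; floor = certified bounds/negative ranges.
Census STRUCTURE bookkeeping of the STPP track (seat pub-omega-stpp-3, gen 25; STRUCTURE row B5, the threshold column
`T2(H) = max {k : (1,2,2)^k ⊆ H}`, lower side), not progress on `ω`: small patterns in small groups bound no exponent.

`P2_2_2_2_2k4r.cls`: the 1 classes of difference pairs `(b' − b, c' − c)` of `ℤ/2 × ℤ/2 × ℤ/2 × ℤ/2 × ℤ/2` (orbits under the listed automorphism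
maps acting diagonally and under the signs of both components; pair code `u·32 + v` ↦ bit), in RANK ORDER: a class needing
a certificate is immediately followed by its dual class (swapped pairs), so that `prank` (`…KernelSearch122R`) makes the dual
flag of every non-certified start strictly smaller.  Pure data; used by `STPPSmallPatternNone122K4Z2pow5.lean` and its `XX` files.

References: H. Cohn, R. Kleinberg, B. Szegedy, C. Umans, FOCS 2005 (arXiv:math/0511460), Def. 5.1.
-/

namespace Summit.MatrixMultiplication.OmegaCensus

namespace STPP122Neg

/-- The pair-class masks of `ℤ/2 × ℤ/2 × ℤ/2 × ℤ/2 × ℤ/2` (`(1,2,2)^4` cell) in rank order (planner `plan25b.py`, seat pub-omega-stpp-3 gen 25). -/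
def P2_2_2_2_2k4r.cls : List ℕ :=
  [89884656690796039165234822243530600149072544648523542263931883955281861052646483691905200773002977504863128194097790256637682793196833400250273594322780785257423161863791203269983787591154697122026241835043180392446050361776103899406719200394390593663178911815370851003414024251832963058149167312425619292160]

end STPP122Neg

end Summit.MatrixMultiplication.OmegaCensus
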